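import Summits.QuantumFields.YangMills.Theorems.BalabanLadderIRTwistedSlabDefs
import HarnessLib

/-!
# Long direction ↔ Euclidean time: T1 is a uniform gap statement for the SPATIAL transfer operator of the twisted slice

HELPER toward stub **T1** `TwistedSlabAnchor` (LINE `twisted-slab-continuity`, crux `IRcof` stmt-QuantumFields-26930, census row 43;
LEAD prover ym-ir-line-tsc-p1 g2; `--supports` the crux, `--as helper`).  A STRUCTURAL identity about T1's own object, from 't Hooft's
rotation covariance of the twisted functional integral (tree: `wilsonFinTorusTensorTwistedPartition_rotate`, lit-4):

* `wilsonFinTorusTensorTwistedPartition_congr` — `W{w}` reads only the entries `μ < ν` of the tensor;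
* `rotateTwistTensor_slabTwist` — under the axis exchange `0 ↔ 1`, `2 ↔ 3` the slab tensor `slabTwist zM zE` becomes `slabTwist zM⁻¹ zE⁻¹`;
* ★ `wilsonFinTorusTensorTwistedPartition_slabTwist_swap` — `W{slabTwist zM zE}(ℓ, ℓ', L, t) = W{slabTwist zM⁻¹ zE⁻¹}(ℓ', ℓ, t, L)`:
  the long direction `2` and Euclidean time `3` of the slab are EXCHANGEABLE (up to inverting the twists);
* ★★ `projSlabZ_swap` — `projSlabZ ρ β z n ℓ L t = projSlabZ ρ β z⁻¹ n ℓ t L` (the average over `k` absorbs `(z^k)⁻¹ = (z⁻¹)^k`);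
* ★★ `projSlabDefect_eq_lengthDoubling` — **the time-doubling purity defect of the e₂-projected tube of length `L` EQUALS the
  LENGTH-doubling free-energy defect `1 − P(2t-long)/P(t-long)²` of the `z⁻¹`-twisted tube at time period `L`**;
* `HasIsolatingTwist.inv` — the isolating property is inversion invariant, so T1's binder is closed under `z ↦ z⁻¹`;
* ★★ `twistedSlabAnchor_iff_lengthDoubling` — hence **T1 ⇔ the same uniform bound `C·L·e^{−ct}` for the length-doubling defect**:
  read through the transfer operator 𝕊_{β,L} ALONG the tube (slice = the twisted `ℓ₀ × ℓ₀` torus × the time circle of period `L`,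
  e-projected), T1 says that 𝕊 has an exponential vacuum dominance `1 − Tr 𝕊^{2t}/(Tr 𝕊^t)² ≤ C·L·e^{−ct}` with RATE `c` UNIFORM in the
  period `L ≥ 2` and in `β ≥ β₀`, and prefactor linear in `L` — the «(U-t) tube gap» of `Cruxes/IRcof/T1-ANATOMY-tsc-p1.md` §4 as an exact
  reformulation rather than a heuristic (g0 had used the direction-2 slicing only as an inequality).

HONEST FRAMING: identities (change of variables) and a rewording of T1; no estimate; T1 0∕1 either way (both readings are the same open
weak-coupling statement); nothing here bears on `IRcof`, `IR`, or the Yang–Mills mass gap (Clay: NOT proved); R4 = `BalabanLadder.UV` only.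
Reference: 't Hooft, Nucl. Phys. B153 (1979) §6 (6.1)–(6.2) (rotation covariance of `W{n_{μν}; a_μ}`).
-/

set_option autoImplicit false

open Literature.MathematicalPhysics.QuantumFieldTheory

namespace Summit.QuantumFields.YangMills.Cruxes.IRcof.TwistedSlab

/-! ## §1 Exchanging the long direction and Euclidean time -/

section Swap

variable {G : Type*} [Group G] [TopologicalSpace G] [IsTopologicalGroup G] [CompactSpace G] [MeasurableSpace G] [BorelSpace G]
  {N : ℕ} (ρ : G →* Matrix (Fin N) (Fin N) ℂ)

/-- `W{w}` depends only on the entries `μ < ν` of the twist tensor. [cite: tHooft1979Flux, §2 (2.5)–(2.6)] -/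
theorem wilsonFinTorusTensorTwistedPartition_congr (β : ℝ) {w w' : Fin 4 → Fin 4 → G}
    (h : ∀ μ ν : Fin 4, μ < ν → w μ ν = w' μ ν) (a b c d : ℕ) :
    wilsonFinTorusTensorTwistedPartition ρ β w a b c d = wilsonFinTorusTensorTwistedPartition ρ β w' a b c d := by
  unfold wilsonFinTorusTensorTwistedPartition wilsonFinTorusPlaqTwistedPartition
  have hx : ∀ (x : FinTorusSite a b c d) (q : {q : Fin 4 × Fin 4 // q.1 < q.2}),
      tHooftTwistTensor w x q.1.1 q.1.2 = tHooftTwistTensor w' x q.1.1 q.1.2 := fun x q => by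
    simp only [tHooftTwistTensor, h _ _ q.2]
  simp only [hx]

omit [TopologicalSpace G] [IsTopologicalGroup G] [CompactSpace G] [MeasurableSpace G] [BorelSpace G] in
/-- Under 't Hooft's rotation `0 ↔ 1`, `2 ↔ 3` the slab tensor becomes the slab tensor of the inverse twists (on the read entries `μ < ν`).
[cite: tHooft1979Flux, §6 (6.1)–(6.2)] -/
theorem rotateTwistTensor_slabTwist (zM zE : G) (μ ν : Fin 4) (h : μ < ν) :
    rotateTwistTensor (slabTwist zM zE) μ ν = slabTwist zM⁻¹ zE⁻¹ μ ν := by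
  fin_cases μ <;> fin_cases ν <;> simp (config := { decide := true }) at h <;> simp [rotateTwistTensor, slabTwist]

/-- ★ **The long direction and Euclidean time of the slab are exchangeable**: `W{slabTwist zM zE}(ℓ, ℓ', L, t) =
W{slabTwist zM⁻¹ zE⁻¹}(ℓ', ℓ, t, L)` (change of variables; any compact `G`, continuous `ρ`, real `β`). [cite: tHooft1979Flux, §6 (6.2)] -/
theorem wilsonFinTorusTensorTwistedPartition_slabTwist_swap (hρ : Continuous ρ) (β : ℝ) (zM zE : G) (ℓ ℓ' L t : ℕ) :
    wilsonFinTorusTensorTwistedPartition ρ β (slabTwist zM zE) ℓ ℓ' L t =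
      wilsonFinTorusTensorTwistedPartition ρ β (slabTwist zM⁻¹ zE⁻¹) ℓ' ℓ t L := by
  rw [wilsonFinTorusTensorTwistedPartition_rotate ρ hρ β _ ℓ ℓ' L t]
  exact wilsonFinTorusTensorTwistedPartition_congr ρ β (fun μ ν h => rotateTwistTensor_slabTwist zM zE μ ν h) _ _ _ _

/-- ★★ **`projSlabZ ρ β z n ℓ L t = projSlabZ ρ β z⁻¹ n ℓ t L`**: the e₂-projected partition function of the tube of length `L` at time
period `t` equals that of the `z⁻¹`-twisted tube of length `t` at time period `L`. [cite: tHooft1979Flux, §6 (6.2)] -/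
theorem projSlabZ_swap (hρ : Continuous ρ) (β : ℝ) (z : G) (n ℓ L t : ℕ) :
    projSlabZ ρ β z n ℓ L t = projSlabZ ρ β z⁻¹ n ℓ t L := by
  unfold projSlabZ
  congr 1
  refine Finset.sum_congr rfl fun k _ => ?_
  rw [wilsonFinTorusTensorTwistedPartition_slabTwist_swap ρ hρ, inv_pow]

/-- ★★ **The time-doubling purity defect of the tube of length `L` IS the length-doubling free-energy defect at time period `L`**
(inverse twist): `projSlabDefect ρ β z n ℓ L t = 1 − projSlabZ ρ β z⁻¹ n ℓ (2t) L / (projSlabZ ρ β z⁻¹ n ℓ t L)²`. [cite: tHooft1979Flux, §6 (6.2)] -/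
theorem projSlabDefect_eq_lengthDoubling (hρ : Continuous ρ) (β : ℝ) (z : G) (n ℓ L t : ℕ) :
    projSlabDefect ρ β z n ℓ L t = 1 - projSlabZ ρ β z⁻¹ n ℓ (2 * t) L / projSlabZ ρ β z⁻¹ n ℓ t L ^ 2 := by
  unfold projSlabDefect
  rw [projSlabZ_swap ρ hρ β z n ℓ L (2 * t), projSlabZ_swap ρ hρ β z n ℓ L t]

end Swap

/-! ## §2 The binder of T1 is closed under `z ↦ z⁻¹` -/

/-- **Isolating twists are inversion invariant**: the pairs with commutator `z⁻¹` are the swapped pairs with commutator `z`. [folklore] -/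
theorem HasIsolatingTwist.inv {G : Type} [Group G] {z : G} (h : HasIsolatingTwist G z) : HasIsolatingTwist G z⁻¹ := by
  obtain ⟨⟨A, B, hAB⟩, hconj, hfin⟩ := h
  have key : ∀ A B : G, B * A * B⁻¹ * A⁻¹ = (A * B * A⁻¹ * B⁻¹)⁻¹ := fun A B => by group
  refine ⟨⟨B, A, by rw [key, hAB]⟩, fun A' B' A'' B'' h' h'' => ?_, fun A' B' h' => ?_⟩
  · have e' : B' * A' * B'⁻¹ * A'⁻¹ = z := by rw [key, h', inv_inv]
    have e'' : B'' * A'' * B''⁻¹ * A''⁻¹ = z := by rw [key, h'', inv_inv]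
    obtain ⟨g, hB, hA⟩ := hconj B' A' B'' A'' e' e''
    exact ⟨g, hA, hB⟩
  · have e' : B' * A' * B'⁻¹ * A'⁻¹ = z := by rw [key, h', inv_inv]
    have hf := hfin B' A' e'
    have hset : {g : G | g * A' * g⁻¹ = A' ∧ g * B' * g⁻¹ = B'} = {g : G | g * B' * g⁻¹ = B' ∧ g * A' * g⁻¹ = A'} := by
      ext g; simp only [Set.mem_setOf_eq]; exact and_comm
    rw [hset]; exact hf

/-! ## §3 T1 reworded: a uniform bound on the length-doubling defect -/

/-- ★★ **T1 ⇔ uniform exponential control of the LENGTH-doubling defect.**  `TwistedSlabAnchor` (time-doubling purity defect of the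
e₂-projected twisted tube `≤ C·L·e^{−ct}`, uniformly in `β ≥ β₀`, `L ≥ 2`, `t ≥ 1`) holds iff the same bound holds for
`1 − projSlabZ(ℓ₀; 2t, L)/projSlabZ(ℓ₀; t, L)²` — the ratio of the e-projected partition functions of tubes of LENGTH `2t` and `t` at the common
time period `L`.  In transfer-operator language: the spatial transfer operator 𝕊_{β,L} of the twisted slice `ℓ₀ × ℓ₀ × (period L)` has
`1 − Tr 𝕊^{2t}/(Tr 𝕊^t)² ≤ C·L·e^{−ct}` with a rate UNIFORM in the period `L` and in `β` (both binders range over the same admissible `z`, by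
`HasIsolatingTwist.inv`). [folklore] -/
theorem twistedSlabAnchor_iff_lengthDoubling :
    TwistedSlabAnchor ↔
      ∀ (G : Type) [Group G] [TopologicalSpace G] [IsTopologicalGroup G] [CompactSpace G],
        IsCompactSimpleLieGroup G → SimplyConnectedSpace G →
        letI : MeasurableSpace G := borel G
        haveI : BorelSpace G := ⟨rfl⟩
        ∀ (z : G) (n : ℕ), z ∈ Subgroup.center G → z ≠ 1 → 0 < n → z ^ n = 1 → HasIsolatingTwist G z →
          ∀ r : LatticeRep G, ∃ (ℓ₀ : ℕ) (β₀ c C : ℝ), 2 ≤ ℓ₀ ∧ 0 < c ∧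
            ∀ β : ℝ, β₀ ≤ β → ∀ L t : ℕ, 2 ≤ L → 1 ≤ t →
              1 - projSlabZ r.ρ β z n ℓ₀ (2 * t) L / projSlabZ r.ρ β z n ℓ₀ t L ^ 2 ≤ C * (L : ℝ) * Real.exp (-(c * (t : ℝ))) := by
  constructor
  · intro hA G _ _ _ _ hG hsc
    letI : MeasurableSpace G := borel G
    haveI : BorelSpace G := ⟨rfl⟩
    intro z n hz hz1 hn hzn hiso r
    obtain ⟨ℓ₀, β₀, c, C, hℓ, hc, h⟩ := hA G hG hsc z⁻¹ n (Subgroup.inv_mem _ hz) (inv_ne_one.mpr hz1) hn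
      (by rw [inv_pow, hzn, inv_one]) hiso.inv r
    refine ⟨ℓ₀, β₀, c, C, hℓ, hc, fun β hβ L t hL ht => ?_⟩
    have h1 := h β hβ L t hL ht
    rwa [projSlabDefect_eq_lengthDoubling r.ρ r.continuous, inv_inv] at h1
  · intro hB G _ _ _ _ hG hsc
    letI : MeasurableSpace G := borel G
    haveI : BorelSpace G := ⟨rfl⟩
    intro z n hz hz1 hn hzn hiso r
    obtain ⟨ℓ₀, β₀, c, C, hℓ, hc, h⟩ := hB G hG hsc z⁻¹ n (Subgroup.inv_mem _ hz) (inv_ne_one.mpr hz1) hn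
      (by rw [inv_pow, hzn, inv_one]) hiso.inv r
    refine ⟨ℓ₀, β₀, c, C, hℓ, hc, fun β hβ L t hL ht => ?_⟩
    rw [projSlabDefect_eq_lengthDoubling r.ρ r.continuous]
    exact h β hβ L t hL ht

end Summit.QuantumFields.YangMills.Cruxes.IRcof.TwistedSlab
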